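import Summits.Langlands.Langlands.Theorems.PhantomRMYoshidaResiduallyYoshidaLiftingGreenbergStablePlane
import Summits.Langlands.Langlands.Theorems.PhantomRMYoshidaResiduallyYoshidaLiftingGreenbergSelmerDefs
import HarnessLib

/-!
# Route `PhantomRMYoshida`, crux `ResiduallyYoshidaLifting` (stmt-Langlands-13639), line `sector-klingen-split`:
# stub RS2 `stub_greenbergDecOfOrdinaryFrame` — a residual ordinary frame gives back the decomposition-group Greenberg condition

Stub-worker file of lead prover-line-stmt-Langlands-13639-c5-0 (skeleton rev 16, sub-goal RS2; the converse of the landed RS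
`stub_selmerClassResiduallyOrdinary`, p171290, at the residual level).

**Theorem (`stub_greenbergDecOfOrdinaryFrame`, registered signature verbatim).**  `p ≠ 2`, `v ∣ p`, `DetC`.  If the residual
representation `τ ↦ M(τ) = (σ̄, B; 0, σ̄')(res τ)` of `G_v = Γ_{ℚ_v}` admits a frame `Q ∈ GL₄(k)` with
`Q M(τ) Q⁻¹ = (A τ, C τ; 0, D τ)`, `A τ = 1` and `D τ = c_τ • 1` for `τ ∈ I_v`, then `B` satisfies the decomposition-group
Greenberg condition `IsGreenbergDecAt p k σ σ' v B` (the nine clauses: Greenberg lines `k x₁ ⊆ σ̄`, `k y₁ ⊆ σ̄'` stable under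
`G_v` and fixed by `I_v`, and a correction `X₀` with `B - δX₀` mapping `y₁` into `k x₁` on `G_v`, killing `y₁` on `I_v` and mapping
all of `σ̄'` into `k x₁` on `I_v`).

**Proof.**  Everything is already residual, so the residual core `greenbergStable_of_identityRows` of N1⁺ (p168218) applies with
`O = k`, `red = id`, `h = 1`, once its input is produced (`greenbergDec_of_ordinaryFrame`):
* the PLANE `N₀ = Q⁻¹ E`, `E = (1; 0) ∈ k⁴ˣ²`: from `M(τ) = Q⁻¹ (A, C; 0, D) Q` and `(A, C; 0, D) E = E A` it is STABLE
  (`M(τ) N₀ = N₀ A τ`), FIXED by inertia (`A τ = 1`), and inertia is SCALAR modulo it: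
  `M(τ) - c • 1 = Q⁻¹ ((1, C; 0, c • 1) - c • 1) Q = Q⁻¹ E (1 - c • 1 ∣ C τ) Q = N₀ W`;
* COLUMN REDUCTION (`exists_mul_identityRows`): `N₀` is injective, so two pivot steps give an invertible `G ∈ M₂(k)` with
  `N = N₀ G` carrying an identity block in two rows `i, j`; stability (`T ↦ G⁻¹ T G`), fixedness and the scalar clause
  (`W ↦ G⁻¹ W`) pass to `N`;
* inertia MOVES both constituents: `τ₀ ∈ I_v` with `ε̄(τ₀) ≠ 1` (`exists_mem_absInertia_epsBar_ne_one`) has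
  `det σ̄(τ₀) = det σ̄'(τ₀) = ε̄(τ₀)⁻¹ ≠ 1` (`DetC`, `det_val_eq_of_det_eq`), so `σ̄(τ₀) ≠ 1 ≠ σ̄'(τ₀)`.
No new definitions, no named fact taken as a hypothesis; Mathlib + the landed N1⁺ file and the `GreenbergSelmerDefs` currency.
-/

noncomputable section

-- `Summit.Langlands.Langlands.…` (summit = sub-problem name, D-0017 layout) trips `dupNamespace` on every decl.
set_option linter.dupNamespace false
set_option autoImplicit false

open IsDedekindDomain Filter
open scoped Matrix
open Literature.NumberTheory.GaloisRepresentations Literature.NumberTheory.Automorphic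
open Summit.Langlands.Langlands.Cruxes.ResiduallyYoshidaLifting.YoshidaDivisorSelmerCount
open Summit.Langlands.Langlands.Cruxes.StableYoshidaCongruence.BurkhardtWeddleTwoThreeAnchor
  (exists_mem_absInertia_epsBar_ne_one det_val_eq_of_det_eq)

namespace Summit.Langlands.Langlands.Cruxes.ResiduallyYoshidaLifting.SectorKlingenSplit.Fibre

/-! ### Column reduction of an injective `4 × 2` matrix -/

/-- Column reduction of an injective `4 × 2` matrix over a field (two pivot steps): after an invertible column operation `G`
it carries an identity `2 × 2` block in two rows `i, j`. [folklore] -/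
theorem exists_mul_identityRows {k : Type*} [Field k] (N₀ : Matrix (Fin 4) (Fin 2) k)
    (hinj : ∀ a : Fin 2 → k, N₀ *ᵥ a = 0 → a = 0) :
    ∃ (G : Matrix (Fin 2) (Fin 2) k) (i j : Fin 4), G.det ≠ 0 ∧
      (N₀ * G) i 0 = 1 ∧ (N₀ * G) i 1 = 0 ∧ (N₀ * G) j 0 = 0 ∧ (N₀ * G) j 1 = 1 := by
  -- first pivot: column `0` of `N₀` is non-zero; normalise row `i` to `(1, 0)`
  obtain ⟨i, hi⟩ : ∃ i, N₀ i 0 ≠ 0 := by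
    by_contra h0
    push Not at h0
    have h1 : N₀ *ᵥ Pi.single 0 1 = 0 := by
      rw [Matrix.mulVec_single_one]
      exact funext h0
    simpa using congrFun (hinj _ h1) 0
  set G₁ : Matrix (Fin 2) (Fin 2) k := !![(N₀ i 0)⁻¹, -((N₀ i 0)⁻¹ * N₀ i 1); 0, 1] with hG₁
  have h10 : (N₀ * G₁) i 0 = 1 := by simp [hG₁, Matrix.mul_apply, Fin.sum_univ_two, hi]
  have h11 : (N₀ * G₁) i 1 = 0 := by
    simp only [hG₁, Matrix.mul_apply, Fin.sum_univ_two, Matrix.of_apply, Matrix.cons_val', Matrix.cons_val_zero,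
      Matrix.cons_val_one, Matrix.cons_val_fin_one, Matrix.empty_val']
    field_simp
    ring
  -- second pivot: column `1` of `N₀ G₁` is non-zero; normalise row `j` to `(0, 1)` keeping row `i`
  obtain ⟨j, hj⟩ : ∃ j, (N₀ * G₁) j 1 ≠ 0 := by
    by_contra h0
    push Not at h0
    have h1 : N₀ *ᵥ (G₁ *ᵥ Pi.single 1 1) = 0 := by
      rw [Matrix.mulVec_mulVec, Matrix.mulVec_single_one]
      exact funext h0
    simpa [hG₁, Matrix.mulVec, dotProduct, Fin.sum_univ_two] using congrFun (hinj _ h1) 1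
  set G₂ : Matrix (Fin 2) (Fin 2) k := !![1, 0; -((N₀ * G₁) j 0 * ((N₀ * G₁) j 1)⁻¹), ((N₀ * G₁) j 1)⁻¹] with hG₂
  refine ⟨G₁ * G₂, i, j, ?_, ?_, ?_, ?_, ?_⟩
  · rw [Matrix.det_mul, hG₁, hG₂, Matrix.det_fin_two_of, Matrix.det_fin_two_of]
    simp [hi, hj]
  · rw [← Matrix.mul_assoc, Matrix.mul_apply, Fin.sum_univ_two, h10, h11]
    simp [hG₂]
  · rw [← Matrix.mul_assoc, Matrix.mul_apply, Fin.sum_univ_two, h10, h11]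
    simp [hG₂]
  · rw [← Matrix.mul_assoc, Matrix.mul_apply, Fin.sum_univ_two]
    simp [hG₂]
    field_simp
    ring
  · rw [← Matrix.mul_assoc, Matrix.mul_apply, Fin.sum_univ_two]
    simp [hG₂, hj]

/-! ### The residual ordinary frame produces the input of the residual core of N1⁺ -/

/-- **The linear algebra of RS2** (over an arbitrary index type `ι` with an inertia predicate `I`).  Let `S, S', B : ι → M₂(k)`
and a frame `Q ∈ GL₄(k)` with `Q (S t, B t; 0, S' t) Q⁻¹ = (A t, C t; 0, D t)` (transported along `finSumFinEquiv`), `A t = 1` and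
`D t = c • 1` for `I t`, and suppose `S t₀ ≠ 1`, `S' t₁ ≠ 1` for some `t₀, t₁` with `I t₀`, `I t₁`.  Then the nine Greenberg clauses
hold: the plane `N₀ = Q⁻¹ (1; 0)` is stable, fixed on `I` with the quotient-scalar clause; column-reduce it to an identity block
(`exists_mul_identityRows`) and apply `greenbergStable_of_identityRows` with `O = k`, `red = id`, `h = 1`. [folklore] -/
theorem greenbergDec_of_ordinaryFrame {k : Type*} [Field k] {ι : Type*} (I : ι → Prop)
    (S S' B : ι → Matrix (Fin 2) (Fin 2) k) (Q : GL (Fin 4) k) (A C D : ι → Matrix (Fin 2) (Fin 2) k)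
    (hQ : ∀ t, Q.val * Matrix.reindex finSumFinEquiv finSumFinEquiv (Matrix.fromBlocks (S t) (B t) 0 (S' t)) * (Q⁻¹).val =
      Matrix.reindex finSumFinEquiv finSumFinEquiv (Matrix.fromBlocks (A t) (C t) 0 (D t)))
    (hA : ∀ t, I t → A t = 1) (hD : ∀ t, I t → ∃ c : k, D t = c • (1 : Matrix (Fin 2) (Fin 2) k))
    (hS : ∃ t, I t ∧ S t ≠ 1) (hS' : ∃ t, I t ∧ S' t ≠ 1) :
    ∃ (X₀ : Matrix (Fin 2) (Fin 2) k) (x₁ y₁ : Fin 2 → k), x₁ ≠ 0 ∧ y₁ ≠ 0 ∧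
      (∀ t, ∃ a : k, S t *ᵥ x₁ = a • x₁) ∧ (∀ t, ∃ b : k, S' t *ᵥ y₁ = b • y₁) ∧
      (∀ t, ∃ c : k, (B t - (S t * X₀ - X₀ * S' t)) *ᵥ y₁ = c • x₁) ∧
      (∀ t, I t → S t *ᵥ x₁ = x₁) ∧ (∀ t, I t → S' t *ᵥ y₁ = y₁) ∧
      (∀ t, I t → (B t - (S t * X₀ - X₀ * S' t)) *ᵥ y₁ = 0) ∧
      ∀ t, I t → ∀ y : Fin 2 → k, ∃ c : k, (B t - (S t * X₀ - X₀ * S' t)) *ᵥ y = c • x₁ := by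
  set e : Fin 2 ⊕ Fin 2 ≃ Fin 4 := finSumFinEquiv with he
  -- the realised family `R t = (S t, B t; 0, S' t)` and its framed form `F t = Q R t Q⁻¹ = (A t, C t; 0, D t)` on `Fin 4`
  obtain ⟨R, hR⟩ : ∃ R : ι → Matrix (Fin 4) (Fin 4) k,
      ∀ t, R t = Matrix.reindex e e (Matrix.fromBlocks (S t) (B t) 0 (S' t)) := ⟨_, fun t => rfl⟩
  obtain ⟨F, hF⟩ : ∃ F : ι → Matrix (Fin 4) (Fin 4) k,
      ∀ t, F t = Matrix.reindex e e (Matrix.fromBlocks (A t) (C t) 0 (D t)) := ⟨_, fun t => rfl⟩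
  have hRF : ∀ t, R t = (Q⁻¹).val * F t * Q.val := fun t => by
    rw [hF, ← hQ t, ← hR, Matrix.mul_assoc, Matrix.mul_assoc, Units.inv_mul, Matrix.mul_one, ← Matrix.mul_assoc,
      Units.inv_mul, Matrix.one_mul]
  -- the plane `N₀ = Q⁻¹ E`, `E = (1; 0)`: STABLE (`R t N₀ = N₀ A t`), FIXED on `I`, inertia SCALAR modulo it
  set E₀ : Matrix (Fin 2 ⊕ Fin 2) (Fin 2) k := Matrix.fromRows (1 : Matrix (Fin 2) (Fin 2) k) (0 : Matrix (Fin 2) (Fin 2) k)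
    with hE₀
  obtain ⟨E, hE⟩ : ∃ E : Matrix (Fin 4) (Fin 2) k, E = E₀.submatrix e.symm id := ⟨_, rfl⟩
  have hE₀A : ∀ t, Matrix.fromBlocks (A t) (C t) 0 (D t) * E₀ = E₀ * A t := fun t => by
    rw [hE₀, Matrix.fromBlocks_mul_fromRows, Matrix.fromRows_mul, Matrix.mul_one, Matrix.mul_zero, add_zero, Matrix.mul_zero,
      add_zero, Matrix.zero_mul, Matrix.one_mul, Matrix.zero_mul]
  have hE₀c : ∀ (X : Matrix (Fin 2) (Fin 2) k) (c : k),
      Matrix.fromBlocks 1 X 0 (c • (1 : Matrix (Fin 2) (Fin 2) k)) - c • (1 : Matrix (Fin 2 ⊕ Fin 2) (Fin 2 ⊕ Fin 2) k) =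
        E₀ * Matrix.fromCols (1 - c • (1 : Matrix (Fin 2) (Fin 2) k)) X := fun X c => by
    rw [hE₀, Matrix.fromRows_mul_fromCols, Matrix.one_mul, Matrix.one_mul, Matrix.zero_mul, Matrix.zero_mul,
      ← Matrix.fromBlocks_one, Matrix.fromBlocks_smul, sub_eq_add_neg, Matrix.fromBlocks_neg, Matrix.fromBlocks_add,
      smul_zero, neg_zero, add_zero, add_zero, add_neg_cancel, ← sub_eq_add_neg]
  have hFE : ∀ t, F t * E = E * A t := fun t => by
    rw [hF, hE, Matrix.reindex_apply, ← Matrix.submatrix_mul _ _ _ _ _ e.symm.bijective, hE₀A t,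
      Matrix.submatrix_mul _ _ e.symm id id Function.bijective_id, Matrix.submatrix_id_id]
  have hFc : ∀ t, I t → ∃ c : k, F t - c • 1 = E * ((Matrix.fromCols (1 - c • (1 : Matrix (Fin 2) (Fin 2) k)) (C t)).submatrix id e.symm) :=
      fun t ht => by
    obtain ⟨c, hc⟩ := hD t ht
    refine ⟨c, ?_⟩
    have h1 : F t - c • 1 = Matrix.reindex e e (Matrix.fromBlocks (A t) (C t) 0 (D t) - c • 1) := by
      rw [hF]
      ext a b
      simp [Matrix.one_apply, Matrix.sub_apply]
    rw [h1, hA t ht, hc, hE₀c, hE, Matrix.reindex_apply, Matrix.submatrix_mul _ _ e.symm id e.symm Function.bijective_id]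
  obtain ⟨N₀, hN₀⟩ : ∃ N₀ : Matrix (Fin 4) (Fin 2) k, N₀ = (Q⁻¹).val * E := ⟨_, rfl⟩
  have hQN₀ : ∀ X : Matrix (Fin 4) (Fin 4) k, (Q⁻¹).val * X * Q.val * N₀ = (Q⁻¹).val * (X * E) := fun X => by
    rw [hN₀, Matrix.mul_assoc, ← Matrix.mul_assoc Q.val, Units.mul_inv, Matrix.one_mul, Matrix.mul_assoc]
  have hstab₀ : ∀ t, R t * N₀ = N₀ * A t := fun t => by
    rw [hRF, hQN₀, hFE, hN₀, Matrix.mul_assoc]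
  have hfix₀ : ∀ t, I t → R t * N₀ = N₀ := fun t ht => by rw [hstab₀, hA t ht, Matrix.mul_one]
  have hsc₀ : ∀ t, I t → ∃ (c : k) (W : Matrix (Fin 2) (Fin 4) k), R t - c • 1 = N₀ * W := fun t ht => by
    obtain ⟨c, hc⟩ := hFc t ht
    refine ⟨c, (Matrix.fromCols (1 - c • (1 : Matrix (Fin 2) (Fin 2) k)) (C t)).submatrix id e.symm * Q.val, ?_⟩
    calc R t - c • 1 = (Q⁻¹).val * (F t - c • 1) * Q.val := by
          rw [Matrix.mul_sub, Matrix.sub_mul, Matrix.mul_smul, Matrix.mul_one, Matrix.smul_mul, Units.inv_mul, hRF]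
      _ = N₀ * ((Matrix.fromCols (1 - c • (1 : Matrix (Fin 2) (Fin 2) k)) (C t)).submatrix id e.symm * Q.val) := by
          rw [hc, hN₀]; simp only [Matrix.mul_assoc]
  -- `N₀` is injective (`Q N₀ = E = (1; 0)`)
  have hinj : ∀ a : Fin 2 → k, N₀ *ᵥ a = 0 → a = 0 := fun a ha => by
    have hEa : E *ᵥ a = 0 := by
      calc E *ᵥ a = Q.val *ᵥ (N₀ *ᵥ a) := by rw [hN₀, Matrix.mulVec_mulVec, ← Matrix.mul_assoc, Units.mul_inv, Matrix.one_mul]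
        _ = 0 := by rw [ha, Matrix.mulVec_zero]
    funext c
    have h := congrFun hEa (e (Sum.inl c))
    rw [hE] at h
    fin_cases c <;>
      simpa [hE₀, he, Matrix.mulVec, dotProduct, Fin.sum_univ_two, Matrix.one_apply] using h
  -- column reduction to an identity block, and the residual core of N1⁺ with `O = k`, `red = id`, `h = 1`
  obtain ⟨G, i, j, hG, hNi0, hNi1, hNj0, hNj1⟩ := exists_mul_identityRows N₀ hinj
  have hGu : IsUnit G.det := isUnit_iff_ne_zero.2 hG
  refine greenbergStable_of_identityRows I (RingHom.id k) R (N₀ * G) i j hNi0 hNi1 hNj0 hNj1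
    (fun t => ⟨G⁻¹ * A t * G, ?_⟩) (fun t ht => ⟨by rw [← Matrix.mul_assoc, hfix₀ t ht], ?_⟩) 1 S S' B (fun t => ?_) hS hS'
  · calc R t * (N₀ * G) = N₀ * A t * G := by rw [← Matrix.mul_assoc, hstab₀]
      _ = N₀ * G * (G⁻¹ * A t * G) := by
          rw [Matrix.mul_assoc N₀ G, Matrix.mul_assoc G⁻¹, Matrix.mul_nonsing_inv_cancel_left G _ hGu, Matrix.mul_assoc]
  · obtain ⟨c, W, hW⟩ := hsc₀ t ht
    exact ⟨c, G⁻¹ * W, by rw [hW, Matrix.mul_assoc, Matrix.mul_nonsing_inv_cancel_left G _ hGu]⟩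
  · rw [hR, inv_one, Units.val_one, Matrix.one_mul, Matrix.mul_one, RingHom.coe_id, Matrix.map_id]

/-! ### Registered form -/

/-- **Registered sub-goal RS2 `stub_greenbergDecOfOrdinaryFrame`** (crux stmt-Langlands-13639, line `sector-klingen-split`,
skeleton rev 16; converse of RS p171290): if the residual representation `τ ↦ (σ̄, B; 0, σ̄')(res τ)` of `G_v` (`v ∣ p`, `DetC`,
`p ≠ 2`) admits a `GL₄(k)`-frame in which it is block upper triangular with inertia TRIVIAL on the plane and SCALAR on the
quotient, then `B` satisfies the decomposition-group Greenberg condition `IsGreenbergDecAt` at `v` (the plane is stable and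
inertia-fixed with the quotient-scalar clause; the residual core `greenbergStable_of_identityRows` of N1⁺ after a column reduction
of the plane's matrix; inertia moves both constituents by `DetC` and `ε̄(τ₀) ≠ 1`).  With RS: the strong Greenberg condition IS
residual Siegel-ordinarity of shape `(0,0,1,1)`. [folklore] -/
theorem stub_greenbergDecOfOrdinaryFrame :
    ∀ (p : ℕ) [Fact p.Prime], p ≠ 2 → ∀ (k : Type) [Field k] [CharP k p] [TopologicalSpace k] [DiscreteTopology k]
      (σ σ' : FramedGaloisRep ℚ k 2) (v : HeightOneSpectrum (NumberField.RingOfIntegers ℚ))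
      (B : Field.absoluteGaloisGroup ℚ → Matrix (Fin 2) (Fin 2) k),
      ((p : ℕ) : NumberField.RingOfIntegers ℚ) ∈ v.asIdeal → DetC p k σ σ' →
      (∃ (Q : GL (Fin 4) k) (A C D : Field.absoluteGaloisGroup (v.adicCompletion ℚ) → Matrix (Fin 2) (Fin 2) k),
        (∀ τ, Q.val * Matrix.reindex finSumFinEquiv finSumFinEquiv
              (Matrix.fromBlocks (σ (absGaloisRestrict ℚ (v.adicCompletion ℚ) τ)).val
                (B (absGaloisRestrict ℚ (v.adicCompletion ℚ) τ)) 0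
                (σ' (absGaloisRestrict ℚ (v.adicCompletion ℚ) τ)).val) * (Q⁻¹).val =
            Matrix.reindex finSumFinEquiv finSumFinEquiv (Matrix.fromBlocks (A τ) (C τ) 0 (D τ))) ∧
        (∀ τ ∈ absInertia (v.adicCompletion ℚ), A τ = 1) ∧
        (∀ τ ∈ absInertia (v.adicCompletion ℚ), ∃ c : k, D τ = c • (1 : Matrix (Fin 2) (Fin 2) k))) →
      IsGreenbergDecAt p k σ σ' v B := by
  intro p _ hp k _ _ _ _ σ σ' v B hv hDet hfr
  obtain ⟨Q, A, C, D, hQ, hA, hD⟩ := hfr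
  set L := absGaloisRestrict ℚ (v.adicCompletion ℚ) with hL
  -- an inertia element `τ₀` with `ε̄(τ₀) ≠ 1` moves both constituents (`det = ε̄⁻¹`)
  obtain ⟨τ₀, hτ₀I, hτ₀⟩ := exists_mem_absInertia_epsBar_ne_one hp v hv
  have hmove : ∀ s : FramedGaloisRep ℚ k 2,
      (∀ g, FramedRep.det s g = (Units.map (ZMod.castHom (dvd_refl p) k).toMonoidHom (εb p g))⁻¹) → (s (L τ₀)).val ≠ 1 :=
      fun s hs h1 => by
    have h2 := det_val_eq_of_det_eq (hs (L τ₀))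
    rw [h1, Matrix.det_one, eq_comm, map_eq_one_iff _ (ZMod.castHom_injective k), Units.val_eq_one, inv_eq_one] at h2
    exact hτ₀ h2
  exact greenbergDec_of_ordinaryFrame (fun τ => τ ∈ absInertia (v.adicCompletion ℚ)) (fun τ => (σ (L τ)).val)
    (fun τ => (σ' (L τ)).val) (fun τ => B (L τ)) Q A C D hQ hA hD ⟨τ₀, hτ₀I, hmove σ fun g => (hDet g).1⟩
    ⟨τ₀, hτ₀I, hmove σ' fun g => (hDet g).2.trans (hDet g).1⟩

end Summit.Langlands.Langlands.Cruxes.ResiduallyYoshidaLifting.SectorKlingenSplit.Fibre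

end
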